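import Literature.AlgebraicGeometry.HodgeTheory.NodalPencilJointSubmersion
import Literature.AlgebraicGeometry.Motives.UniversalHypersurfaceRegularLocusLift
import Literature.Geometry.ComplexAnalytic.ChartRadiusCutoff
import HarnessLib

/-!
# Lifted vector fields on `𝒴°(ℂ)` tangent to the Morse shells of a monomial pencil near a node

Family `hodge`, layer `Literature/AlgebraicGeometry/HodgeTheory`. Written by the prover seat `hodge-nonav-prover-Bx` (g14, cell
`hodge-nonav`) as a brick of the ODP-ISOTOPY port (memo `PROGRAMME-ODP-ISOTOPY-Bx-g13` §2, Picard–Lefschetz binder of crux K1-B,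
stmt-HodgeConjecture-19716): the generalisation of prover-Ax's `CyclicCoverPencilShellFields` (step A1b-γ for the quaternary cyclic
pencil `x₃^p = f₁ + c·x₂^p`) to an arbitrary degree `d`, `n + 2` variables, chart `xᵢ ≠ 0` and monomial pencil direction `xᵢ^d` on the
regular locus `𝒴°(ℂ)` of the universal family, with an ORDINARY DOUBLE POINT read through a Morse chart `Θ` of `ℂⁿ⁺¹` in which the
solved coefficient of `xᵢ^d` is `c₀ + Σⱼ (Θ y)ⱼ²` (`NodalPencilJointSubmersion`).

The SHELL SET `K` is the (closed) set of points whose remaining coefficients are prescribed (`b'`) and whose affine coordinates `y`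
lie in the Morse shell `s₀² ≤ Σⱼ|Θ y|ⱼ² ≤ r₂²` with `|φ(y)| ≤ δ` for a continuous `φ` (the pencil coordinate minus its critical value).
Every `C^∞` vector field `W` of the coefficient space lifts to a `C^∞` vector field on `𝒴°(ℂ)` TANGENT TO THE MORSE SHELLS along
`K`: its derivative kills the cut-off Morse radius `ρ̃ = regChartExtend n d i (ChartRadius.cutoff Θ R'' R' ∘ y)` there.

* `affineShell`, `isCompact_affineShell`, `mem_affineShell`; `shellSet`, `isClosed_shellSet`, `mem_shellSet_coords`;
* `surjective_mfderiv_on_shellSet` — `(b, ρ̃)` is submersive along `K` (`NodalPencilJointSubmersion` + `ChartRadiusCutoff`);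
* `exists_shell_tangent_lift` — **the lifted field: `db(X) = W(b)` everywhere, `dρ̃(X) = 0` on `K`**
  (`Motives/UniversalHypersurfaceRegularLocusLift`).

Everything is proved; the two definitions are concrete; no named facts. Honest scope: plumbing of the classical construction of the
geometric monodromy of a Lefschetz pencil near a node; nothing here says HC or any rung is proved.

## References

* [ArnoldGuseinzadeVarchenko2012] V. I. Arnold, S. M. Gusein-Zade, A. N. Varchenko, Singularities of Differentiable Maps II (2012),
  Part I §1.1, §2.1 (the monodromy vector field is tangent to the boundary of the Milnor ball).
* [BrockerJanichIDT1982] T. Bröcker, K. Jänich, Introduction to Differential Topology (1982), (8.12).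
* [VoisinHodgeII2003] C. Voisin, Hodge Theory and Complex Algebraic Geometry II (2003), §2.3 (Lefschetz pencils).
-/

noncomputable section

open CategoryTheory AlgebraicGeometry MvPolynomial TopologicalSpace Set Topology Filter
open scoped Manifold ContDiff LinearAlgebra.Projectivization
open Literature.AlgebraicGeometry.Motives Literature.AlgebraicGeometry.Motives.UniversalHypersurface
open Literature.AlgebraicGeometry.HodgeTheory.UniversalHypersurface Literature.Geometry.ComplexAnalytic
open Literature.NumberTheory.Transcendental

namespace Literature.AlgebraicGeometry.HodgeTheory

namespace NodalPencil

variable {n : ℕ} (Θ : OpenPartialHomeomorph (Fin (n + 1) → ℂ) (Fin (n + 1) → ℂ)) (φ : (Fin (n + 1) → ℂ) → ℂ)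
  (s₀ r₂ δ : ℝ)

/-! ### The affine shell -/

/-- The affine shell region `C = Θ⁻¹{s₀² ≤ Σ|z|² ≤ r₂²} ∩ {|φ(y)| ≤ δ} ⊆ ℂⁿ⁺¹`. [cite: ArnoldGuseinzadeVarchenko2012, Part I §2.1] -/
def affineShell : Set (Fin (n + 1) → ℂ) :=
  Θ.symm '' (Θ.target ∩ {z | s₀ ^ 2 ≤ ∑ j, ‖z j‖ ^ 2 ∧ ∑ j, ‖z j‖ ^ 2 ≤ r₂ ^ 2}) ∩ {y | ‖φ y‖ ≤ δ}

/-- The affine shell region is compact when `φ` is continuous and `{Σ|z|² ≤ R'} ⊆ Θ.target` for some `R' ≥ r₂²`.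
[cite: ArnoldGuseinzadeVarchenko2012, Part I §2.1] -/
theorem isCompact_affineShell (hφ : Continuous φ) {R' : ℝ} (hR' : {z : Fin (n + 1) → ℂ | ∑ j, ‖z j‖ ^ 2 ≤ R'} ⊆ Θ.target)
    (hr : r₂ ^ 2 ≤ R') : IsCompact (affineShell Θ φ s₀ r₂ δ) := by
  have hA : IsCompact (Θ.target ∩ {z : Fin (n + 1) → ℂ | s₀ ^ 2 ≤ ∑ j, ‖z j‖ ^ 2 ∧ ∑ j, ‖z j‖ ^ 2 ≤ r₂ ^ 2}) := by
    have hsub : Θ.target ∩ {z : Fin (n + 1) → ℂ | s₀ ^ 2 ≤ ∑ j, ‖z j‖ ^ 2 ∧ ∑ j, ‖z j‖ ^ 2 ≤ r₂ ^ 2} ⊆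
        {z : Fin (n + 1) → ℂ | ∑ j, ‖z j‖ ^ 2 ≤ R'} := fun z hz => hz.2.2.trans hr
    have hcont : Continuous fun z : Fin (n + 1) → ℂ => ∑ j, ‖z j‖ ^ 2 := by fun_prop
    have hclosed : IsClosed (Θ.target ∩ {z : Fin (n + 1) → ℂ | s₀ ^ 2 ≤ ∑ j, ‖z j‖ ^ 2 ∧ ∑ j, ‖z j‖ ^ 2 ≤ r₂ ^ 2}) := by
      have heq : Θ.target ∩ {z : Fin (n + 1) → ℂ | s₀ ^ 2 ≤ ∑ j, ‖z j‖ ^ 2 ∧ ∑ j, ‖z j‖ ^ 2 ≤ r₂ ^ 2} =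
          {z : Fin (n + 1) → ℂ | s₀ ^ 2 ≤ ∑ j, ‖z j‖ ^ 2 ∧ ∑ j, ‖z j‖ ^ 2 ≤ r₂ ^ 2} :=
        Set.inter_eq_right.mpr fun z hz => hR' (hz.2.trans hr)
      rw [heq]
      exact (isClosed_le continuous_const hcont).inter (isClosed_le hcont continuous_const)
    exact (ChartRadius.isCompact_sumNormSq_le R').of_isClosed_subset hclosed hsub
  have hAt : Θ.target ∩ {z : Fin (n + 1) → ℂ | s₀ ^ 2 ≤ ∑ j, ‖z j‖ ^ 2 ∧ ∑ j, ‖z j‖ ^ 2 ≤ r₂ ^ 2} ⊆ Θ.target :=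
    Set.inter_subset_left
  have himg := hA.image_of_continuousOn (Θ.continuousOn_symm.mono hAt)
  have hφc : Continuous fun y : Fin (n + 1) → ℂ => ‖φ y‖ := hφ.norm
  exact himg.inter_right (isClosed_le hφc continuous_const)

/-- Points of the affine shell: in the source, with the shell inequalities. [cite: ArnoldGuseinzadeVarchenko2012, Part I §2.1] -/
theorem mem_affineShell {y : Fin (n + 1) → ℂ} (hy : y ∈ affineShell Θ φ s₀ r₂ δ) :
    y ∈ Θ.source ∧ s₀ ^ 2 ≤ ∑ j, ‖Θ y j‖ ^ 2 ∧ ∑ j, ‖Θ y j‖ ^ 2 ≤ r₂ ^ 2 ∧ ‖φ y‖ ≤ δ := by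
  obtain ⟨⟨z, hz, rfl⟩, hφ⟩ := hy
  refine ⟨Θ.map_target hz.1, ?_, ?_, hφ⟩
  · rw [Θ.right_inv hz.1]; exact hz.2.1
  · rw [Θ.right_inv hz.1]; exact hz.2.2

/-! ### The shell set in `𝒴°(ℂ)` -/

variable (d : ℕ) (i : Fin (n + 2)) (b' : {m : DegIndex n d // m ≠ regPowIndex n d i} → ℂ)

/-- **The shell set `K ⊆ 𝒴°(ℂ)`**: homogeneous coordinates in `stdChartInv i (affineShell)` and prescribed coefficients `b'` off `xᵢ^d`.
[cite: ArnoldGuseinzadeVarchenko2012, Part I §2.1] -/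
def shellSet : Set (ComplexPoints (regularTotal ℂ n d)) :=
  {Q | hypersurfacePoint (regularToProjectiveSpace ℂ n d) Q ∈ Projectivization.stdChartInv i '' affineShell Θ φ s₀ r₂ δ} ∩
    {Q | ∀ m : {m : DegIndex n d // m ≠ regPowIndex n d i}, regCoeff ℂ n d Q m.1 = b' m}

/-- **`K` is closed** (the image of the compact affine shell in the Hausdorff `ℙ(ℂⁿ⁺²)` is closed; the coefficients are continuous).
[cite: ArnoldGuseinzadeVarchenko2012, Part I §2.1] -/
theorem isClosed_shellSet (hd : 0 < d) (hφ : Continuous φ) {R' : ℝ}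
    (hR' : {z : Fin (n + 1) → ℂ | ∑ j, ‖z j‖ ^ 2 ≤ R'} ⊆ Θ.target) (hr : r₂ ^ 2 ≤ R') :
    IsClosed (shellSet Θ φ s₀ r₂ δ d i b') := by
  haveI : T2Space (ℙ ℂ (Fin (n + 2) → ℂ)) := Projectivization.t2Space_pi
  have h1 : IsClosed {Q : ComplexPoints (regularTotal ℂ n d) |
      hypersurfacePoint (regularToProjectiveSpace ℂ n d) Q ∈ Projectivization.stdChartInv i '' affineShell Θ φ s₀ r₂ δ} :=
    (((isCompact_affineShell Θ φ s₀ r₂ δ hφ hR' hr).image (Projectivization.continuous_stdChartInv i)).isClosed).preimage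
      (continuous_hypersurfacePoint _)
  have h2 : IsClosed {Q : ComplexPoints (regularTotal ℂ n d) |
      ∀ m : {m : DegIndex n d // m ≠ regPowIndex n d i}, regCoeff ℂ n d Q m.1 = b' m} := by
    haveI := locallyOfFiniteType_regularTotal_hom ℂ n d hd
    haveI := smoothOfRelativeDimension_regularTotal_hom ℂ n d hd
    letI := ComplexPoints.chartedSpace (regularTotal ℂ n d) (n + Fintype.card (DegIndex n d))
    have hc : Continuous fun Q : ComplexPoints (regularTotal ℂ n d) => regCoeff ℂ n d Q :=
      continuous_iff_continuousAt.mpr fun Q => (contMDiffAt_regCoeff n d hd Q).continuousAt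
    rw [show {Q : ComplexPoints (regularTotal ℂ n d) | ∀ m : {m : DegIndex n d // m ≠ regPowIndex n d i}, regCoeff ℂ n d Q m.1 = b' m} =
        ⋂ m : {m : DegIndex n d // m ≠ regPowIndex n d i}, {Q | regCoeff ℂ n d Q m.1 = b' m} by ext Q; simp]
    exact isClosed_iInter fun m => isClosed_eq ((continuous_apply m.1).comp hc) continuous_const
  exact h1.inter h2

/-- **Coordinates of a point of `K`**: it lies in the chart domain, its affine coordinates `y` lie in the affine shell, and its
remaining chart coordinates are `b'`. [cite: ArnoldGuseinzadeVarchenko2012, Part I §2.1] -/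
theorem mem_shellSet_coords {Q : ComplexPoints (regularTotal ℂ n d)} (hQ : Q ∈ shellSet Θ φ s₀ r₂ δ d i b') :
    Q ∈ regChartDom n d i ∧ (fun j => regChartFun n d i Q (Sum.inr j)) ∈ affineShell Θ φ s₀ r₂ δ ∧
      ∀ m : {m : DegIndex n d // m ≠ regPowIndex n d i}, regChartFun n d i Q (Sum.inl m) = b' m := by
  obtain ⟨⟨c, hc, hcQ⟩, hb⟩ := hQ
  have hdom : Q ∈ regChartDom n d i := by
    rw [regChartDom_eq_preimage, Set.mem_preimage, ← hcQ, Projectivization.stdChart_source]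
    exact Projectivization.stdChartInv_mem_stdChartSource i c
  refine ⟨hdom, ?_, fun m => hb m⟩
  have hy : (fun j => regChartFun n d i Q (Sum.inr j)) = c := by
    funext j
    change Projectivization.stdChart i (hypersurfacePoint (regularToProjectiveSpace ℂ n d) Q) j = c j
    rw [← hcQ, Projectivization.stdChart_apply, Projectivization.stdChartFun_stdChartInv]
  rw [hy]; exact hc

/-! ### The submersion along the shell set and the tangent lift -/

/-- **`(b, ρ̃)` is submersive along `K`** for `ρ̃ = regChartExtend (ChartRadius.cutoff Θ R'' R' ∘ y)`: `Θ` a `C^∞` chart with `C^∞`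
inverse in which the solved coefficient of `xᵢ^d` at the remaining coefficients `b'` is `c₀ + Σⱼ (Θ y)ⱼ²`, `φ(y)` that solved coefficient
minus `c₀`, radii `0 < s₀ ≤ r₂`, `r₂² < R'' < R'`, `{Σ|z|² ≤ R'} ⊆ Θ.target`, and `δ < s₀²`.
[cite: ArnoldGuseinzadeVarchenko2012, Part I §2.1] [cite: VoisinHodgeII2003, §2.3] -/
theorem surjective_mfderiv_on_shellSet (hd : 0 < d)
    (hΘ : ContDiffOn ℝ ∞ Θ Θ.source) (hΘs : ContDiffOn ℝ ∞ Θ.symm Θ.target) (c₀ : ℂ)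
    (hΘc : ∀ y ∈ Θ.source, regChartCoeffVec n d i (Sum.elim b' y) (regPowIndex n d i) = c₀ + ∑ j, (Θ y j) ^ 2)
    (hφ : ∀ y, φ y = regChartCoeffVec n d i (Sum.elim b' y) (regPowIndex n d i) - c₀)
    {R'' R' : ℝ} (hs₀ : 0 < s₀) (hR'' : r₂ ^ 2 < R'') (hR : R'' < R')
    (hR' : {z : Fin (n + 1) → ℂ | ∑ j, ‖z j‖ ^ 2 ≤ R'} ⊆ Θ.target) (hδ : δ < s₀ ^ 2)
    {Q : ComplexPoints (regularTotal ℂ n d)} (hQ : Q ∈ shellSet Θ φ s₀ r₂ δ d i b') :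
    haveI := locallyOfFiniteType_regularTotal_hom ℂ n d hd
    haveI := smoothOfRelativeDimension_regularTotal_hom ℂ n d hd
    letI := ComplexPoints.chartedSpace (regularTotal ℂ n d) (n + Fintype.card (DegIndex n d))
    Function.Surjective (mfderiv (𝓡 (2 * (n + Fintype.card (DegIndex n d)))) 𝓘(ℝ, (DegIndex n d → ℂ) × ℝ)
      (fun Q' => (regCoeff ℂ n d Q',
        regChartExtend n d i (fun v => ChartRadius.cutoff Θ R'' R' (fun j => v (Sum.inr j))) Q')) Q) := by
  obtain ⟨hdom, hyC, hb⟩ := mem_shellSet_coords Θ φ s₀ r₂ δ d i b' hQ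
  obtain ⟨hys, hlow, hup, hφy⟩ := mem_affineShell Θ φ s₀ r₂ δ hyC
  have hlin : ContDiff ℝ ∞ (fun v : ChartIdx n d i → ℂ => (fun j : Fin (n + 1) => v (Sum.inr j))) :=
    contDiff_pi.2 fun j => contDiff_apply ℝ ℂ (Sum.inr j : ChartIdx n d i)
  have hBcont : ContDiff ℝ ∞ (fun v : ChartIdx n d i → ℂ => ChartRadius.cutoff Θ R'' R' (fun j => v (Sum.inr j))) :=
    (ChartRadius.contDiff_cutoff Θ R'' R' hΘ hR hR').comp hlin
  have hBloc : (fun v : ChartIdx n d i → ℂ => ChartRadius.cutoff Θ R'' R' (fun j => v (Sum.inr j))) =ᶠ[𝓝 (regChartFun n d i Q)]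
      fun v => ∑ j, ‖Θ (fun j => v (Sum.inr j)) j‖ ^ 2 := by
    have hev := ChartRadius.cutoff_eventuallyEq Θ R'' R' hR hys (lt_of_le_of_lt hup hR'')
    have ht : Tendsto (fun v : ChartIdx n d i → ℂ => (fun j : Fin (n + 1) => v (Sum.inr j))) (𝓝 (regChartFun n d i Q))
        (𝓝 (fun j => regChartFun n d i Q (Sum.inr j))) := hlin.continuous.continuousAt
    exact hev.comp_tendsto ht
  -- the pencil coordinate of `Q` is within `δ < s₀²` of the critical value
  have hv₀ : regChartFun n d i Q = Sum.elim b' (fun j => regChartFun n d i Q (Sum.inr j)) := by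
    funext s
    rcases s with m | j
    · exact hb m
    · rfl
  have hc : ‖regCoeff ℂ n d Q (regPowIndex n d i) - c₀‖ < s₀ ^ 2 := by
    rw [regCoeff_eq_regChartCoeffVec n d i hdom, hv₀, ← hφ]
    exact lt_of_le_of_lt hφy hδ
  exact surjective_mfderiv_regCoeff_prod_chartRadius n d i hd Θ hΘ hΘs b' c₀ hΘc hs₀ _ hBcont hdom hb hys hlow hc hBloc

/-- **The lifted field tangent to the Morse shells.** Under the hypotheses of `surjective_mfderiv_on_shellSet` (and `φ` continuous,
`s₀ ≤ r₂` not needed), for every `C^∞` vector field `W` of the coefficient space there is a `C^∞` vector field `X` on `𝒴°(ℂ)` with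
`db(X) = W(b)` everywhere and `dρ̃(X) = 0` on the shell set `K`, `ρ̃ = regChartExtend n d i (ChartRadius.cutoff Θ R'' R' ∘ y)`.
[cite: ArnoldGuseinzadeVarchenko2012, Part I §2.1] [cite: BrockerJanichIDT1982, (8.12)] -/
theorem exists_shell_tangent_lift (hd : 0 < d) (hφc : Continuous φ)
    (hΘ : ContDiffOn ℝ ∞ Θ Θ.source) (hΘs : ContDiffOn ℝ ∞ Θ.symm Θ.target) (c₀ : ℂ)
    (hΘc : ∀ y ∈ Θ.source, regChartCoeffVec n d i (Sum.elim b' y) (regPowIndex n d i) = c₀ + ∑ j, (Θ y j) ^ 2)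
    (hφ : ∀ y, φ y = regChartCoeffVec n d i (Sum.elim b' y) (regPowIndex n d i) - c₀)
    {R'' R' : ℝ} (hs₀ : 0 < s₀) (hR'' : r₂ ^ 2 < R'') (hR : R'' < R')
    (hR' : {z : Fin (n + 1) → ℂ | ∑ j, ‖z j‖ ^ 2 ≤ R'} ⊆ Θ.target) (hδ : δ < s₀ ^ 2)
    {W : (DegIndex n d → ℂ) → (DegIndex n d → ℂ)} (hW : ContDiff ℝ ∞ W) :
    haveI := locallyOfFiniteType_regularTotal_hom ℂ n d hd
    haveI := smoothOfRelativeDimension_regularTotal_hom ℂ n d hd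
    letI := ComplexPoints.chartedSpace (regularTotal ℂ n d) (n + Fintype.card (DegIndex n d))
    haveI := ComplexPoints.isManifold_real (regularTotal ℂ n d) (n + Fintype.card (DegIndex n d))
    ∃ X : Π Q : ComplexPoints (regularTotal ℂ n d), TangentSpace (𝓡 (2 * (n + Fintype.card (DegIndex n d)))) Q,
      ContMDiff (𝓡 (2 * (n + Fintype.card (DegIndex n d)))) (𝓡 (2 * (n + Fintype.card (DegIndex n d)))).tangent ∞
        (fun Q => (⟨Q, X Q⟩ : TangentBundle (𝓡 (2 * (n + Fintype.card (DegIndex n d)))) (ComplexPoints (regularTotal ℂ n d)))) ∧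
      (∀ Q, mfderiv (𝓡 (2 * (n + Fintype.card (DegIndex n d)))) 𝓘(ℝ, DegIndex n d → ℂ) (fun Q' => regCoeff ℂ n d Q') Q (X Q) =
        W (regCoeff ℂ n d Q)) ∧
      ∀ Q ∈ shellSet Θ φ s₀ r₂ δ d i b',
        mfderiv (𝓡 (2 * (n + Fintype.card (DegIndex n d)))) 𝓘(ℝ, ℝ)
          (regChartExtend n d i (fun v => ChartRadius.cutoff Θ R'' R' (fun j => v (Sum.inr j)))) Q (X Q) = 0 := by
  have hlin : ContDiff ℝ ∞ (fun v : ChartIdx n d i → ℂ => (fun j : Fin (n + 1) => v (Sum.inr j))) :=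
    contDiff_pi.2 fun j => contDiff_apply ℝ ℂ (Sum.inr j : ChartIdx n d i)
  have hBcont : ContDiff ℝ ∞ (fun v : ChartIdx n d i → ℂ => ChartRadius.cutoff Θ R'' R' (fun j => v (Sum.inr j))) :=
    (ChartRadius.contDiff_cutoff Θ R'' R' hΘ hR hR').comp hlin
  obtain ⟨R, hRb⟩ := ChartRadius.exists_bound_cutoff Θ R'' R' hR hR'
  have hBR : ∀ v : ChartIdx n d i → ℂ, R < ‖fun j => v (Sum.inr j)‖ →
      ChartRadius.cutoff Θ R'' R' (fun j => v (Sum.inr j)) = 0 := fun v hv => hRb _ hv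
  have hK := isClosed_shellSet Θ φ s₀ r₂ δ d i b' hd hφc hR' (hR''.le.trans hR.le)
  exact exists_contMDiff_lift_tangent_regChartExtend n d i hd hW _ hBcont hBR hK
    (fun Q hQ => surjective_mfderiv_on_shellSet Θ φ s₀ r₂ δ d i b' hd hΘ hΘs c₀ hΘc hφ hs₀ hR'' hR hR' hδ hQ)

end NodalPencil

end Literature.AlgebraicGeometry.HodgeTheory

end
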